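import Literature.Geometry.Lorentzian.CoordChartLorentz
import Literature.Geometry.Lorentzian.CoordChartSlicePrep
import Literature.Geometry.Lorentzian.CoordSlice
import HarnessLib

/-!
# Route SwallowTheDatum · item `SubdataDevelopmentsEmbed` (stmt-FinalStateConjecture-10053) —
# chart-level lemmas for the restart of local uniqueness (Sbierski 2016, §3.2, proof of Thm. 12)

Second of five files. Lemmas about two time-oriented Lorentzian metrics on the target of a chart
`Φ` of `M₁` adapted to a time function `f` (`(Φ q)⁰ = f q`), the second one the pullback of the
metric of `M₂` along `ψ ∘ Φ⁻¹` for a local extension `ψ` of the glueing map: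

* `mem_closure_image_of_level` — slice points `x⁰ = 0` of the target lie in the closure of
  `Φ(U ∩ Φ.source)` when `{f = 0} ∩ W ⊆ Ū`;
* `eqOn_repr_of_pullback_eq` — the two coordinate metrics agree on `Φ(U ∩ Φ.source)` when
  `ψ^* g₂ = g₁` on `U ∩ Φ.source`;
* `exists_radius_spacelike_slice` — `dx⁰ > 0` on the transported future cone at `Φ p₀`, and a ball
  about `Φ p₀` on which the slices are spacelike with future-pointing normal (Wald 1984, (10.2.10));
* `cone_agree_of_closure` — cone agreement of the two time orientations at the points of the closure
  where the metrics agree (continuity; O'Neill 1983, Ch. 5, Lemma 5.26 ff.);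
* `chartPushforward_props` — `ψ ∘ Φ⁻¹` is a smooth injective immersion of the target;
* `isFutureDirected_transfer_of_agree` — future-directedness transfers between the two structures at
  a point where the metrics agree.

Everything is proved; no definitions, no named facts.
-/

noncomputable section

open Bundle Set Function Filter TopologicalSpace Manifold Topology Metric
open scoped Manifold ContDiff Topology

namespace Summit.FinalStateConjecture.FinalStateConjecture.Theorems

namespace SubdataDevelopmentsEmbed

open Literature.Geometry.Lorentzian

/-! ### In an adapted chart: slice points lie over the level set; agreement of representatives;
a radius on which the slices are spacelike -/

/-- **Slice points of an adapted chart lie in the closure of the image of `U`.** If `(Φ q)⁰ = f q`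
on `Φ.source ⊆ W` and every zero of `f` in `W` lies in `Ū`, then every point of `Φ.target` with
vanishing first coordinate lies in the closure of `Φ(U ∩ Φ.source)` (continuity of `Φ` at
`Φ⁻¹ x ∈ Ū ∩ Φ.source`). [cite: Sbierski2016AHP, §3.2, proof of Thm. 12 ("`S ⊆ Ū`")] -/
theorem mem_closure_image_of_level {M : Type*} [TopologicalSpace M]
    {Φ : OpenPartialHomeomorph M E4} {f : M → ℝ} {U W : Set M}
    (hΦf : ∀ q ∈ Φ.source, Φ q 0 = f q) (hsrcW : Φ.source ⊆ W)
    (hlevel : ∀ q ∈ W, f q = 0 → q ∈ closure U) {x : E4} (hx : x ∈ Φ.target) (hx0 : x 0 = 0) :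
    x ∈ closure (Φ '' (U ∩ Φ.source)) := by
  have hxs : Φ.symm x ∈ Φ.source := Φ.map_target hx
  have hfx : f (Φ.symm x) = 0 := by
    rw [← hΦf _ hxs, Φ.right_inv hx]; exact hx0
  have hcl : Φ.symm x ∈ closure U := hlevel _ (hsrcW hxs) hfx
  have hcl' : Φ.symm x ∈ closure (U ∩ Φ.source) := by
    have h := Φ.open_source.inter_closure (t := U) ⟨hxs, hcl⟩
    rwa [inter_comm] at h
  have hcont : ContinuousWithinAt Φ (U ∩ Φ.source) (Φ.symm x) :=
    (Φ.continuousAt hxs).continuousWithinAt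
  have h := hcont.mem_closure_image hcl'
  rwa [Φ.right_inv hx] at h

/-- **The two coordinate metrics agree on `Φ(U ∩ Φ.source)`.** If `ψ^* g₂ = g₁` at the points of
`U ∩ Φ.source`, then the representative `G` of `(Φ⁻¹)^* g₁` (`CoordChart.metricRepr`) and any
representative `G'` of `(ψ ∘ Φ⁻¹)^* g₂` (hypothesis `hG'`: its value formula) agree on
`Φ(U ∩ Φ.source)`. [cite: Sbierski2016AHP, §3.2, proof of Thm. 12] -/
theorem eqOn_repr_of_pullback_eq {M₁ M₂ : Type*} [TopologicalSpace M₁] [ChartedSpace E4 M₁]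
    [IsManifold (𝓡 4) ∞ M₁] [TopologicalSpace M₂] [ChartedSpace E4 M₂] [IsManifold (𝓡 4) ∞ M₂]
    (g₁ : LorentzianMetric (𝓡 4) ∞ M₁) (g₂ : LorentzianMetric (𝓡 4) ∞ M₂)
    {Φ : OpenPartialHomeomorph M₁ E4} (hΦ : Φ ∈ IsManifold.maximalAtlas (𝓡 4) ∞ M₁) {ψ : M₁ → M₂}
    {U : Set M₁}
    (hiso : ∀ q ∈ U ∩ Φ.source, pullbackBilin (I := 𝓡 4) (I' := 𝓡 4) ψ g₂.val q = g₁.val q)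
    {G' : E4 → E4 →L[ℝ] E4 →L[ℝ] ℝ}
    (hG' : ∀ (x : CoordChart.target Φ) (u w : E4), G' x u w = g₂.val (ψ (CoordChart.inv Φ x))
      (mfderiv (𝓡 4) (𝓡 4) ψ (CoordChart.inv Φ x)
        (mfderiv 𝓘(ℝ, E4) (𝓡 4) (CoordChart.inv Φ) x u))
      (mfderiv (𝓡 4) (𝓡 4) ψ (CoordChart.inv Φ x)
        (mfderiv 𝓘(ℝ, E4) (𝓡 4) (CoordChart.inv Φ) x w))) :
    EqOn (CoordChart.metricRepr g₁.toPseudoRiemannianMetric hΦ) G' (Φ '' (U ∩ Φ.source)) := by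
  rintro _ ⟨q, ⟨hqU, hqs⟩, rfl⟩
  have hx : Φ q ∈ Φ.target := Φ.map_source hqs
  have hq : Φ.symm (Φ q) = q := Φ.left_inv hqs
  have hinvq : CoordChart.inv Φ ⟨Φ q, hx⟩ = q := hq
  ext u w
  rw [← CoordChart.lorentzMetric_val_apply_eq_repr g₁ hΦ ⟨Φ q, hx⟩, CoordChart.lorentzMetric_val_apply,
    hG' ⟨Φ q, hx⟩, hinvq, hq]
  have hk := congrArg (fun b ↦ b (mfderiv 𝓘(ℝ, E4) (𝓡 4) (CoordChart.inv Φ) ⟨Φ q, hx⟩ u)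
    (mfderiv 𝓘(ℝ, E4) (𝓡 4) (CoordChart.inv Φ) ⟨Φ q, hx⟩ w)) (hiso q ⟨hqU, hqs⟩)
  simp only [pullbackBilin_apply] at hk
  exact hk.symm

/-- **A radius about `x₀ = Φ p₀` on which the slices `{x⁰ = const}` are spacelike with
future-pointing normal.** In a chart `Φ` adapted to a function `f` whose differential at `p₀` is
positive on the future causal cone: `dx⁰` is positive on the transported future cone at `Φ p₀`
(`CoordChart.pos_of_isFutureDirected`), so `lapseSq > 0` and `(Φ_* T)⁰ > 0` at `Φ p₀`
(`CoordChart.lapseSq_metricRepr_pos`), and both conditions hold on a ball about `Φ p₀` (continuity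
of `lapseSq`, `IsMetricOn.contDiffOn_lapseSq`, and of the transported orienting field).
[cite: Wald1984, §10.2, (10.2.10)] -/
theorem exists_radius_spacelike_slice {M : Type*} [TopologicalSpace M] [ChartedSpace E4 M]
    [IsManifold (𝓡 4) ∞ M] (g : LorentzianMetric (𝓡 4) ∞ M) (τ : TimeOrientation g)
    {Φ : OpenPartialHomeomorph M E4} (hΦ : Φ ∈ IsManifold.maximalAtlas (𝓡 4) ∞ M) {f : M → ℝ}
    {p₀ : M} (hp₀Φ : p₀ ∈ Φ.source) (hfd : MDifferentiableAt (𝓡 4) 𝓘(ℝ, ℝ) f p₀)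
    (hdf : ∀ v : TangentSpace (𝓡 4) p₀, τ.IsFutureDirected v →
      (0 : ℝ) < mfderiv (𝓡 4) 𝓘(ℝ, ℝ) f p₀ v)
    (hdt : ∀ q ∈ Φ.source, CoordSlice.dt (Φ q) = f q) :
    (∀ v : TangentSpace 𝓘(ℝ, E4) (⟨Φ p₀, Φ.map_source hp₀Φ⟩ : CoordChart.target Φ),
        (CoordChart.timeOrientation g τ hΦ).IsFutureDirected v → (0 : ℝ) < CoordSlice.dt v) ∧
      ∃ r₁ > 0, ∀ x : CoordChart.target Φ,
        dist x (⟨Φ p₀, Φ.map_source hp₀Φ⟩ : CoordChart.target Φ) < r₁ →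
          0 < MetricCoord.lapseSq (CoordChart.metricRepr g.toPseudoRiemannianMetric hΦ)
            CoordSlice.dt x ∧
          0 < CoordSlice.dt ((CoordChart.timeOrientation g τ hΦ).vectorField x : E4) := by
  set a : CoordChart.target Φ := ⟨Φ p₀, Φ.map_source hp₀Φ⟩ with ha
  set G := CoordChart.metricRepr g.toPseudoRiemannianMetric hΦ with hG_def
  set τT := CoordChart.timeOrientation g τ hΦ with hτT_def
  have hsymm₀ : Φ.symm (a : E4) = p₀ := Φ.left_inv hp₀Φ
  have hfd' : MDifferentiableAt (𝓡 4) 𝓘(ℝ, ℝ) f (Φ.symm (a : E4)) := by rw [hsymm₀]; exact hfd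
  have hdf' : ∀ v : TangentSpace (𝓡 4) (Φ.symm (a : E4)),
      τ.IsFutureDirected v → (0 : ℝ) < mfderiv (𝓡 4) 𝓘(ℝ, ℝ) f (Φ.symm (a : E4)) v := by
    rw [hsymm₀]; exact hdf
  have hpos : ∀ v : TangentSpace 𝓘(ℝ, E4) a, τT.IsFutureDirected v → (0 : ℝ) < CoordSlice.dt v :=
    fun v hv ↦ CoordChart.pos_of_isFutureDirected hΦ hdt hfd' hdf' hv
  have hlapse₀ : 0 < MetricCoord.lapseSq G CoordSlice.dt (a : E4) :=
    CoordChart.lapseSq_metricRepr_pos hΦ hdt hfd' hdf'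
  have hT₀ : 0 < CoordSlice.dt (τT.vectorField a : E4) := hpos _ (τT.isFutureDirected_vectorField a)
  have hG : ∀ x : CoordChart.target Φ, (CoordChart.lorentzMetric g hΦ).val x = G x :=
    CoordChart.lorentzMetric_val_eq_repr g hΦ
  have hmetG : MetricCoord.IsMetricOn G (Φ.target : Set E4) :=
    OpensChart.isMetricOn_repr (g := (CoordChart.lorentzMetric g hΦ).toPseudoRiemannianMetric) hG
  have hcont_ab : Continuous (fun x : CoordChart.target Φ ↦
      (MetricCoord.lapseSq G CoordSlice.dt x, CoordSlice.dt (τT.vectorField x : E4))) := by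
    refine Continuous.prodMk ?_ ?_
    · exact (hmetG.contDiffOn_lapseSq (ℓ := CoordSlice.dt)).continuousOn.comp_continuous
        continuous_subtype_val fun x ↦ x.2
    · exact CoordSlice.dt.continuous.comp (OpensChart.continuous_of_contMDiff_section τT.contMDiff)
  refine ⟨hpos, ?_⟩
  have hopen : IsOpen {x : CoordChart.target Φ | 0 < MetricCoord.lapseSq G CoordSlice.dt x ∧
      0 < CoordSlice.dt (τT.vectorField x : E4)} :=
    (isOpen_Ioi.prod isOpen_Ioi).preimage hcont_ab
  obtain ⟨r₁, hr₁, h⟩ := Metric.isOpen_iff.1 hopen a ⟨hlapse₀, hT₀⟩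
  exact ⟨r₁, hr₁, fun x hx ↦ h hx⟩

/-! ### Future cones of two metrics on a chart domain agreeing on the closure of an open set -/

/-- **Cone agreement by continuity.** Let `(g₁, τ₁)`, `(g₂, τ₂)` be time-oriented Lorentzian
metrics on a chart domain `T ⊆ E4`, and suppose the pairing `g₂(T₂, T₁)` of the orienting fields
is negative at the points of `T` over a set `O₀`. Then at every `x ∈ T` over the closure of `O₀` at
which `g₁ = g₂` (pointwise): `g₂(T₂, T₁)(x) < 0` (it is `≤ 0` by continuity of the pairing,
`OpensChart.continuous_val_apply_of_contMDiff`, and nonzero since both vectors are timelike for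
`g₂_x = g₁_x`, O'Neill 1983, Ch. 5, Lemma 5.26), so `T₁(x)` is `τ₂`-future-directed and every
`τ₂`-future vector at `x` is `τ₁`-future (`isFutureDirected_of_val_lt_zero`,
`IsFutureDirected.val_lt_zero`). [cite: ONeillSemiRiemannian1983, Ch. 5, Lemma 5.26 and p. 145] -/
theorem cone_agree_of_closure {T : Opens E4} {g₁ g₂ : LorentzianMetric 𝓘(ℝ, E4) ∞ T}
    (τ₁ : TimeOrientation g₁) (τ₂ : TimeOrientation g₂) {G₂ : E4 → E4 →L[ℝ] E4 →L[ℝ] ℝ}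
    (hG₂ : ∀ x : T, g₂.val x = G₂ x) {O₀ : Set E4}
    (hneg : ∀ x : T, (x : E4) ∈ O₀ → g₂.val x (τ₂.vectorField x) (τ₁.vectorField x) < 0)
    {x : T} (hx : (x : E4) ∈ closure O₀)
    (hagree : ∀ u w : E4, g₁.val x u w = g₂.val x u w) :
    g₂.val x (τ₂.vectorField x) (τ₁.vectorField x) < 0 ∧ τ₂.IsFutureDirected (τ₁.vectorField x) ∧
      ∀ v : TangentSpace 𝓘(ℝ, E4) x, τ₂.IsFutureDirected v → τ₁.IsFutureDirected v := by
  have hPcont : Continuous (fun y : T ↦ g₂.val y (τ₂.vectorField y) (τ₁.vectorField y)) :=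
    OpensChart.continuous_val_apply_of_contMDiff (g := g₂.toPseudoRiemannianMetric) hG₂
      τ₂.contMDiff τ₁.contMDiff
  have ht : g₁.IsTimelike (τ₁.vectorField x) := τ₁.isTimelike x
  have ht' : g₂.IsTimelike (τ₁.vectorField x) := by
    show g₂.val x (τ₁.vectorField x) (τ₁.vectorField x) < 0
    rw [← hagree]; exact ht
  have hcone : g₂.val x (τ₂.vectorField x) (τ₁.vectorField x) < 0 := by
    have hle : g₂.val x (τ₂.vectorField x) (τ₁.vectorField x) ≤ 0 := by
      by_contra hpos
      have hpos : 0 < g₂.val x (τ₂.vectorField x) (τ₁.vectorField x) := not_le.1 hpos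
      have hopen : IsOpen {y : T | 0 < g₂.val y (τ₂.vectorField y) (τ₁.vectorField y)} :=
        isOpen_lt continuous_const hPcont
      have himg : IsOpen (Subtype.val '' {y : T | 0 < g₂.val y (τ₂.vectorField y)
          (τ₁.vectorField y)}) := T.isOpen.isOpenMap_subtype_val _ hopen
      obtain ⟨z, ⟨⟨y, hy, rfl⟩, hzO⟩⟩ := mem_closure_iff.1 hx _ himg ⟨x, hpos, rfl⟩
      exact absurd (hneg y hzO) (not_lt.2 hy.le)
    have hne : g₂.val x (τ₂.vectorField x) (τ₁.vectorField x) ≠ 0 :=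
      g₂.val_ne_zero_of_isTimelike_of_isCausal (τ₂.isTimelike x) ⟨ht'.le, ht.ne_zero⟩
    exact lt_of_le_of_ne hle hne
  have hfut : τ₂.IsFutureDirected (τ₁.vectorField x) := ⟨⟨ht'.le, ht.ne_zero⟩, hcone⟩
  refine ⟨hcone, hfut, fun v hv ↦ ?_⟩
  have h1 : g₂.val x (τ₁.vectorField x) v < 0 :=
    TimeOrientation.IsFutureDirected.val_lt_zero τ₂ hfut ht' hv
  have h2 : g₁.val x (τ₁.vectorField x) v < 0 := by rw [hagree]; exact h1
  have hc : g₁.IsCausal v := by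
    refine ⟨?_, hv.1.2⟩
    rw [hagree]; exact hv.1.1
  exact ⟨hc, h2⟩

/-! ### The extension read on the chart target: `ψ ∘ Φ⁻¹` -/

/-- **The push-forward `ψΦ = ψ ∘ Φ⁻¹` of a local injective immersion to the chart target** is smooth
(`C^{∞+1} = C^∞`), injective, with injective differentials `d(ψΦ) = dψ ∘ dΦ⁻¹` (chain rule), when
`Φ.source` lies in an open set on which `ψ` is a smooth injective immersion. [cite: Sbierski2016AHP, §3.2, Lemma 14] -/
theorem chartPushforward_props {M₁ M₂ : Type*} [TopologicalSpace M₁] [ChartedSpace E4 M₁]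
    [IsManifold (𝓡 4) ∞ M₁] [TopologicalSpace M₂] [ChartedSpace E4 M₂] [IsManifold (𝓡 4) ∞ M₂]
    {Φ : OpenPartialHomeomorph M₁ E4} (hΦ : Φ ∈ IsManifold.maximalAtlas (𝓡 4) ∞ M₁)
    {ψ : M₁ → M₂} {O : Set M₁} (hO : IsOpen O) (hψs : ContMDiffOn (𝓡 4) (𝓡 4) ∞ ψ O)
    (hΦO : Φ.source ⊆ O) (hψinj : InjOn ψ O) (hψimm : ∀ q ∈ O, Injective (mfderiv (𝓡 4) (𝓡 4) ψ q)) :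
    ContMDiff 𝓘(ℝ, E4) (𝓡 4) (∞ + 1) (fun x : CoordChart.target Φ ↦ ψ (CoordChart.inv Φ x)) ∧
      (∀ x : CoordChart.target Φ, MDifferentiableAt (𝓡 4) (𝓡 4) ψ (CoordChart.inv Φ x)) ∧
      (∀ x : CoordChart.target Φ,
        mfderiv 𝓘(ℝ, E4) (𝓡 4) (fun x : CoordChart.target Φ ↦ ψ (CoordChart.inv Φ x)) x =
          (mfderiv (𝓡 4) (𝓡 4) ψ (CoordChart.inv Φ x)).comp
            (mfderiv 𝓘(ℝ, E4) (𝓡 4) (CoordChart.inv Φ) x)) ∧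
      (∀ x : CoordChart.target Φ, Injective
        (mfderiv 𝓘(ℝ, E4) (𝓡 4) (fun x : CoordChart.target Φ ↦ ψ (CoordChart.inv Φ x)) x)) ∧
      Injective (fun x : CoordChart.target Φ ↦ ψ (CoordChart.inv Φ x)) := by
  have hinvs : ContMDiff 𝓘(ℝ, E4) (𝓡 4) ∞ (CoordChart.inv Φ) := CoordChart.contMDiff_inv' hΦ
  have hinvO : ∀ x : CoordChart.target Φ, CoordChart.inv Φ x ∈ O := fun x ↦
    hΦO (CoordChart.inv_mem_source x)
  have hψat : ∀ x : CoordChart.target Φ, ContMDiffAt (𝓡 4) (𝓡 4) ∞ ψ (CoordChart.inv Φ x) := fun x ↦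
    (hψs _ (hinvO x)).contMDiffAt (hO.mem_nhds (hinvO x))
  have hs : ContMDiff 𝓘(ℝ, E4) (𝓡 4) ∞ (fun x : CoordChart.target Φ ↦ ψ (CoordChart.inv Φ x)) :=
    fun x ↦ (hψat x).comp x (hinvs x)
  have hd : ∀ x : CoordChart.target Φ, MDifferentiableAt (𝓡 4) (𝓡 4) ψ (CoordChart.inv Φ x) := fun x ↦
    (hψat x).mdifferentiableAt (by simp)
  have hmf : ∀ x : CoordChart.target Φ,
      mfderiv 𝓘(ℝ, E4) (𝓡 4) (fun x : CoordChart.target Φ ↦ ψ (CoordChart.inv Φ x)) x =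
        (mfderiv (𝓡 4) (𝓡 4) ψ (CoordChart.inv Φ x)).comp
          (mfderiv 𝓘(ℝ, E4) (𝓡 4) (CoordChart.inv Φ) x) := fun x ↦
    mfderiv_comp x (hd x) ((hinvs x).mdifferentiableAt (by simp))
  refine ⟨?_, hd, hmf, fun x ↦ ?_, fun x x' h ↦ ?_⟩
  · have h : ((∞ : ℕ∞ω) + 1) = ∞ := rfl
    rw [h]; exact hs
  · rw [hmf x]
    exact (hψimm _ (hinvO x)).comp (CoordChart.injective_mfderiv_inv hΦ x)
  · have h' : CoordChart.inv Φ x = CoordChart.inv Φ x' := hψinj (hinvO x) (hinvO x') h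
    exact (CoordChart.isOpenEmbedding_inv Φ).injective h'

/-! ### Transfer of the future slice normal between two metrics agreeing at a slice point -/

/-- **A future-directed vector for `(g, τ)` is future-directed for `(g', τ')` at a point where
`g = g'` and `T` is `τ'`-future** (the causal cone is the same; the vector lies in the cone of the
`τ'`-future timelike `T`: `isFutureDirected_of_val_lt_zero`). O'Neill 1983, Ch. 5, p. 145.
[cite: ONeillSemiRiemannian1983, Ch. 5, Lemma 5.26 and p. 145] -/
theorem isFutureDirected_transfer_of_agree {T : Opens E4} {g g' : LorentzianMetric 𝓘(ℝ, E4) ∞ T}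
    (τ : TimeOrientation g) (τ' : TimeOrientation g') {x : T}
    (hval : ∀ u w : E4, g.val x u w = g'.val x u w) (hT : τ'.IsFutureDirected (τ.vectorField x))
    {N : E4} (hN : τ.IsFutureDirected (x := x) N) : τ'.IsFutureDirected (x := x) N := by
  have ht' : g'.IsTimelike (τ.vectorField x) := by
    have ht : g.IsTimelike (τ.vectorField x) := τ.isTimelike _
    show g'.val _ _ _ < 0
    rw [← hval]; exact ht
  refine τ'.isFutureDirected_of_val_lt_zero hT ht' ?_ ?_
  · refine ⟨?_, hN.1.2⟩
    show g'.val _ _ _ ≤ 0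
    rw [← hval]; exact hN.1.1
  · show g'.val _ _ _ < 0
    rw [← hval]; exact hN.2

end SubdataDevelopmentsEmbed

end Summit.FinalStateConjecture.FinalStateConjecture.Theorems

end
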